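import Mathlib
import Summits.Ventures.HodgeRepro2.T6NAut3
import Summits.Ventures.HodgeRepro2.T6N5Hyp
import Summits.Ventures.HodgeRepro2.T6N5Rich

/-!
# T6N5RichMain — the three M2 residual binders of N5 (`hL5` / `ha5` / `hb5` of `periodInputN_of_published₆`)
discharged on the composition carrier `NAut3` from a rich N5 datum, and the N5 block of the composition in
the re-cut shape

Tier 6 (README §10), sub-step N5 of the M2 discharge (t6-p7 with t6-p8).  M2 v6 (T6PeriodInput6, p407424)
consumes N5 on the carrier's datum `M.d5 : N5Skeleton.N5Data M.ι5 M.G5` through the binders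
`hT : Hyp.BFGYYZ2025_Thm5_6 {M.d5.A, M.d5.B}` [PO], `hL5` (N5.L1 ×2), `ha5` ((a) ×2), `hb5` ((b) ×2)
[IR ×3] and `hc5 : M.d5.condC` [EX].  With a rich datum `R : N5Rich.RichData M.ι5 M.G5` whose skeleton
pair IS the carrier's (`hR : M.d5 = R.toN5Data` — the carrier's N5 sides are the sides built from the
representation carriers and the sign model, class EX: by construction, in the pattern of t6-p6's
`hxA : M.sA.d43 = XA.toPlaces` of v5), the three IR binders are theorems (`residuals_of_rich`) modulo
the construction facts `R.LevelHyps` (smoothness / projector / stability / equivariance of the two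
representation carriers, class EX), the (S–H) identity `R.SH` (TIER5 (A5): the datum's line characters
are chosen with χ_aχ_b = χ_cχ_d on E¹(𝔸) — identically for the choice of record χ₁₀₁ := χ₁₁₁,
χ₁₁₀ := χ₁₀₀; its transport from t6-p5's `N2Datum.HChi` needs a diagonal-restriction dictionary the
carrier does not carry), the datum's local solutions `R.S.Solves` (t6-p8's Theorem N5.T2 per finite
non-split place; the choice is the datum's, `N5Rich.exists_signModel` / `exists_solves` the kernel
witnesses), and condition (b) at the REAL places `R.S.RealCondB` (the route's residual, MEMO §10.4(C) —
the one interface residual left).  `N5_of_rich` / `iiA_and_iiB_of_rich` are the N5 block of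
`periodInputN_of_mains₃` in this shape — what a v7 composition would consume in place of
`hL5 ha5 hb5` (offered to the lead, nothing imposed; `NAut3` untouched).

§8(d): uses an L-value-free non-vanishing device: NO.
-/

namespace Summit.Ventures.HodgeRepro2.T6.N5RichMain

open Summit.Ventures.HodgeRepro2.T6.N5Skeleton Summit.Ventures.HodgeRepro2.T6.N5Rich
  Summit.Ventures.HodgeRepro2.T6.N5LocalDatum Summit.Ventures.HodgeRepro2.T6.N5Local

section CarrierFree

variable {ι G : Type*} [CommGroup G]

/-- THE KERNEL WITNESS OF THE (D-ξ) CHOICE AT THE DATUM LEVEL (class EX made explicit): if the coupled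
local system is solvable at every finite non-split place of a rich datum's sign model (t6-p8's per-place
theorems), the datum can be re-chosen — same representation carriers, same kinds, same local data, same
real-place signs, same characters `f`, `rA`, `rB`, same central values — so that its line characters solve
it (`Solves`). -/
theorem exists_solves (R : RichData ι G)
    (h : ∀ v, R.S.kind v = .ns → ∃ ξ : Fin 4 → (R.S.D v).Char, LocalSolution (R.S.D v) ξ) :
    ∃ R' : RichData ι G, R'.repA = R.repA ∧ R'.repB = R.repB ∧ R'.S.kind = R.S.kind ∧ R'.S.D = R.S.D ∧
      R'.S.omegaRA = R.S.omegaRA ∧ R'.S.epsRA = R.S.epsRA ∧ R'.S.omegaRB = R.S.omegaRB ∧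
      R'.S.epsRB = R.S.epsRB ∧ R'.f = R.f ∧ R'.rA = R.rA ∧ R'.rB = R.rB ∧ R'.LvalA = R.LvalA ∧
      R'.LvalB = R.LvalB ∧ R'.S.Solves := by
  obtain ⟨S, hk, hD, hoA, heA, hoB, heB, hsol⟩ :=
    exists_signModel R.S.kind R.S.D h R.S.omegaRA R.S.epsRA R.S.omegaRB R.S.epsRB
  exact ⟨{ R with S := S }, rfl, rfl, hk, hD, hoA, heA, hoB, heB, rfl, rfl, rfl, rfl, rfl, hsol⟩

/-- Re-choosing the line characters does not move the sides' `LevelHyps`, `SH` or `RealCondB`: the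
re-chosen datum of `exists_solves` keeps every other hypothesis of `RichData.N5_of`. -/
theorem exists_solves_all (R : RichData ι G)
    (h : ∀ v, R.S.kind v = .ns → ∃ ξ : Fin 4 → (R.S.D v).Char, LocalSolution (R.S.D v) ξ)
    (hL : R.LevelHyps) (hSH : R.SH) (hre : R.S.RealCondB) :
    ∃ R' : RichData ι G, R'.LevelHyps ∧ R'.SH ∧ R'.S.Solves ∧ R'.S.RealCondB := by
  obtain ⟨R', hA, hB, hk, -, hoA, heA, hoB, heB, -, hrA, hrB, -, -, hsol⟩ := exists_solves R h
  refine ⟨R', ?_, ?_, hsol, ?_⟩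
  · unfold RichData.LevelHyps
    rw [hA, hB]
    exact hL
  · unfold RichData.SH
    rw [hrA, hrB]
    exact hSH
  · intro v hv i
    rw [hk] at hv
    rw [hoA, heA, hoB, heB]
    exact hre v hv i

end CarrierFree

section Carrier

variable {K : Type*} [Field K] [NumberField K] [NumberField.IsCMField K] {F : FaceSetting K}
  {P : NDatum F}

/-- THE THREE M2 v6 RESIDUAL BINDERS OF N5 ON THE CARRIER: for a rich datum whose skeleton pair is the
carrier's `d5`, Lemma N5.L1 on both sides, (a) on both sides and (b) on both sides are theorems from the
construction facts, (S–H), the local solutions and (b) at the real places — exactly the conjunction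
`hL5 ∧ ha5 ∧ hb5` of `periodInputN_of_published₆`. -/
theorem residuals_of_rich (M : NAut3 F P) (R : RichData M.ι5 M.G5) (hR : M.d5 = R.toN5Data)
    (hL : R.LevelHyps) (hSH : R.SH) (hsol : R.S.Solves) (hre : R.S.RealCondB) :
    (M.d5.A.levelReduction ∧ M.d5.B.levelReduction) ∧ (M.d5.A.condA ∧ M.d5.B.condA) ∧
      (M.d5.A.condB ∧ M.d5.B.condB) := by
  rw [hR]
  exact R.residuals hL hSH hsol hre

/-- THE N5 BLOCK OF THE COMPOSITION IN THE RE-CUT SHAPE: Theorem 5.6 on the carrier's two sides [PO], the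
rich datum with `hR` [EX], the construction facts [EX], (S–H) [EX], the local solutions [EX, witnessed
per place by t6-p8's theorems], (b) at the real places [IR] and (c) at the datum's twist [EX] give
`M.N5` — in place of v6's `hL5 ha5 hb5`. -/
theorem N5_of_rich (M : NAut3 F P)
    (hT : Hyp.BFGYYZ2025_Thm5_6 ({M.d5.A, M.d5.B} : Set (ToricSide M.ι5 M.G5)))
    (R : RichData M.ι5 M.G5) (hR : M.d5 = R.toN5Data)
    (hL : R.LevelHyps) (hSH : R.SH) (hsol : R.S.Solves) (hre : R.S.RealCondB) (hc : M.d5.condC) :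
    M.N5 := by
  obtain ⟨hL5, ha5, hb5⟩ := residuals_of_rich M R hR hL hSH hsol hre
  exact N5Data.N5_of_residual (hT _ (Or.inl rfl)) (hT _ (Or.inr rfl)) hL5.1 hL5.2 ha5.1 ha5.2
    hb5.1 hb5.2 hc

/-- Proposition N*'s hypotheses (ii) on both sides from the re-cut N5 block (through the carrier's
compat fields, as `periodInputN_of_mains₃` uses them). -/
theorem iiA_and_iiB_of_rich (M : NAut3 F P)
    (hT : Hyp.BFGYYZ2025_Thm5_6 ({M.d5.A, M.d5.B} : Set (ToricSide M.ι5 M.G5)))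
    (R : RichData M.ι5 M.G5) (hR : M.d5 = R.toN5Data)
    (hL : R.LevelHyps) (hSH : R.SH) (hsol : R.S.Solves) (hre : R.S.RealCondB) (hc : M.d5.condC) :
    M.iiA ∧ M.iiB :=
  M.iiA_and_iiB_of_N5 (N5_of_rich M hT R hR hL hSH hsol hre hc)

end Carrier

end Summit.Ventures.HodgeRepro2.T6.N5RichMain
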